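import Summits.QuantumAdvantage.AdviceFreeQNC0.AdditiveLDMAProductBound
import HarnessLib

/-!
# Cell qa-qnc0 (rung F-Q1, route RingFrame, crux α, line `product`): ADDITIVE LDMA suffices, and the
# LEVEL-SET chain `FW ⟹ FSB ⟹ LDMAAdd ⟹ ProductHard`

Planner qa-qnc0-p1's TARGET §20.7 / `Sketch8b.lean` (asks P6a–c), typed verbatim and PROVED:

* (`AdditiveLDMAProductBound.lean`) `productHard_of_ldmaAddSuff_of_elimHard` (= `Sketch8b.ProductOfLDMAAdd`):
  ADDITIVE LDMA with error/constant ratio an arbitrarily small constant (`LDMAAddSuff`) and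
  elimination hardness give `ProductHardPolylog` (`μ = κη₀/2`).
* `ldmaAddSuff_of_fsbSuff` (= `Sketch8b.LDMAAddOfFSB`, S): FAR-SET BALANCE
  `|FAR_{τ/c} ∩ cls r| ≥ κ'·|FAR_τ| − τ''·2^L` (all scales `τ`, slacks `τ''`, one ratio `c`, one `κ'`)
  gives additive LDMA with `κ = τκ'/c`, `E = (τ/c)(κ'τ + τ'')`.
* `fsbSuff_of_fwSuff` (= `Sketch8b.FSBOfFW`, S): a ONE-SIDED LOW-DEGREE FARNESS WITNESS (`FW`: a
  Boolean `p` of degree `≤ D' L` capturing an `a`-fraction of the `τ`-far rows, with at most a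
  `b`-fraction of `supp p` among the `(τ/c)`-near rows of class `r`) plus PLDAMS at profile `D'`
  gives far-set balance with `κ' = a(κ₀ − b)`: `|FAR_{τ/c} ∩ cls r| ≥ |supp p ∩ cls r| − |supp p ∩
  NEAR ∩ cls r| ≥ (κ₀ − b)|supp p| ≥ (κ₀ − b)·|supp p ∩ FAR_τ|`.

With `pldamsBool_sqrt` (`LDMATransfer.lean`): `FWSuff ⌊c√·⌋ ⟹ FSBSuff ⟹ LDMAAddSuff ⟹ [ElimHard]
ProductHardPolylog ⟹ … ⟹ α` — all arrows kernel theorems; `productHard_of_fwSuff_of_elimHard` (any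
profile `D'` carrying PLDAMS) and `productHard_of_fwSuff_sqrt_of_elimHard` (profile `⌊c'√n⌋`, all small
`c'`) package the first three.  Vocabulary (`far`, `near`, `FSB`, `FSBSuff`, `FW`, `FWSuff`) verbatim from `Sketch8b` (`LDMAAdd`,
`LDMAAddSuff` in `AdditiveLDMAProductBound.lean`); `cls`, `PLDAMSBool` are the cell topic's
(`LDMATransfer.lean`, same bodies).

WHAT THIS IS NOT: `FW` / `FSB` / `LDMAAdd` for general column degree are OPEN (that is the crux);
nothing on α itself; no separation claim.
-/

noncomputable section

namespace Summit.QuantumAdvantage.AdviceFreeQNC0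

open Finset
open Literature.Computability.MetaComplexity Literature.Computability.MetaComplexity.Smolensky

/-! ### Vocabulary (verbatim from `Sketch8b`) -/

/-- rows at relative distance `≥ θ` from the fail code (`FAR_θ`). -/
def far {L L' : ℕ} (D : ℕ) (Γ : (Fin L → Bool) → (Fin L' → Bool) → Bool) (θ : ℝ) :
    Finset (Fin L → Bool) :=
  univ.filter fun u : Fin L → Bool => θ * (2 : ℝ) ^ L' ≤ (distFail D (Γ u) : ℝ)

/-- rows at relative distance `< θ` from the fail code (`NEAR_θ`). -/
def near {L L' : ℕ} (D : ℕ) (Γ : (Fin L → Bool) → (Fin L' → Bool) → Bool) (θ : ℝ) :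
    Finset (Fin L → Bool) :=
  univ.filter fun u : Fin L → Bool => (distFail D (Γ u) : ℝ) < θ * (2 : ℝ) ^ L'

/-- **Far-set balance** at scale `τ`, sandwich ratio `c`, constants `κ'`, `τ''`. -/
def FSB (c κ' τ τ'' : ℝ) : Prop :=
  ∀ C : ℕ, ∃ L₀ : ℕ, ∀ L L' : ℕ, L₀ ≤ L → L₀ ≤ L' → ∀ D : ℕ, D ≤ (Nat.log 2 (min L L')) ^ C →
    ∀ Γ : (Fin L → Bool) → (Fin L' → Bool) → Bool, (∀ v, HasDeg (fun u => Γ u v) D) → ∀ r : ℕ,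
      κ' * ((far D Γ τ).card : ℝ) - τ'' * (2 : ℝ) ^ L ≤ ((far D Γ (τ / c) ∩ cls L r).card : ℝ)

/-- The sufficient family: one `c`, one `κ'`, every scale `τ` and every slack `τ''`. -/
def FSBSuff : Prop := ∃ c : ℝ, 1 ≤ c ∧ ∃ κ' : ℝ, 0 < κ' ∧ ∀ τ : ℝ, 0 < τ → ∀ τ'' : ℝ, 0 < τ'' → FSB c κ' τ τ''

/-- **One-sided low-degree farness witness** at scale `τ`, ratio `c`, capture `a`, leakage `b`,
degree profile `D'`, slack `τ''`. -/
def FW (D' : ℕ → ℕ) (c a b τ τ'' : ℝ) : Prop :=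
  ∀ C : ℕ, ∃ L₀ : ℕ, ∀ L L' : ℕ, L₀ ≤ L → L₀ ≤ L' → ∀ D : ℕ, D ≤ (Nat.log 2 (min L L')) ^ C →
    ∀ Γ : (Fin L → Bool) → (Fin L' → Bool) → Bool, (∀ v, HasDeg (fun u => Γ u v) D) → ∀ r : ℕ,
      ∃ p : (Fin L → Bool) → Bool, HasDeg p (D' L) ∧
        a * ((far D Γ τ).card : ℝ) - τ'' * (2 : ℝ) ^ L ≤
          (((univ.filter fun u : Fin L → Bool => p u = true) ∩ far D Γ τ).card : ℝ) ∧
        (((univ.filter fun u : Fin L → Bool => p u = true) ∩ near D Γ (τ / c) ∩ cls L r).card : ℝ) ≤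
          b * ((univ.filter fun u : Fin L → Bool => p u = true).card : ℝ)

/-- The sufficient family: fixed profile `D'`, ratio `c`, capture `a`; every leakage `b > 0`, scale, slack. -/
def FWSuff (D' : ℕ → ℕ) : Prop :=
  ∃ c : ℝ, 1 ≤ c ∧ ∃ a : ℝ, 0 < a ∧ ∀ b : ℝ, 0 < b → ∀ τ : ℝ, 0 < τ → ∀ τ'' : ℝ, 0 < τ'' → FW D' c a b τ τ''

/-! ### Elementary facts on `far` / `near` / `distFail` -/

/-- `NEAR_θ` and `FAR_θ` partition the rows. -/
theorem far_eq_compl_near {L L' : ℕ} (D : ℕ) (Γ : (Fin L → Bool) → (Fin L' → Bool) → Bool) (θ : ℝ) :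
    far D Γ θ = univ.filter fun u : Fin L → Bool => ¬ u ∈ near D Γ θ := by
  unfold far near
  ext u
  simp only [Finset.mem_filter, Finset.mem_univ, true_and, not_lt]

/-- The potential cost of a row is at most `2^{L'}` (the all-fail pattern is in `𝓕`). -/
theorem distFail_le_pow {L' : ℕ} (D : ℕ) (z : (Fin L' → Bool) → Bool) : distFail D z ≤ 2 ^ L' := by
  refine le_trans (distFail_le z (isElimFail_true D)) ?_
  unfold hdist
  calc (univ.filter fun v : Fin L' → Bool => z v ≠ true).card ≤ (univ : Finset (Fin L' → Bool)).card :=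
        Finset.card_le_card (Finset.filter_subset _ _)
    _ = 2 ^ L' := by rw [Finset.card_univ, Fintype.card_fun, Fintype.card_bool, Fintype.card_fin]

/-! ### P6b: far-set balance gives additive LDMA -/

/-- **Level sets ⟹ additive LDMA** (`Sketch8b.LDMAAddOfFSB`): `κ = τκ'/c`, `E = (τ/c)(κ'τ + τ'')`;
the rows nearer than `τ/c` are dropped at additive cost, the far rows cost between `(τ/c)2^{L'}` and
`2^{L'}` each. -/
theorem ldmaAdd_of_fsb {c κ' τ τ'' : ℝ} (hc : 1 ≤ c) (hκ' : 0 < κ') (hτ : 0 < τ)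
    (h : FSB c κ' τ τ'') : LDMAAdd (τ * κ' / c) (τ / c * (κ' * τ + τ'')) := by
  intro C
  obtain ⟨L₀, hL₀⟩ := h C
  refine ⟨L₀, fun L L' hL hL' D hD Γ hΓ r => ?_⟩
  have hfsb := hL₀ L L' hL hL' D hD Γ hΓ r
  have hcpos : (0 : ℝ) < c := by linarith
  have h2L : (0 : ℝ) ≤ (2 : ℝ) ^ L := by positivity
  have h2L' : (0 : ℝ) < (2 : ℝ) ^ L' := by positivity
  -- (1) total cost ≤ |FAR_τ|·2^{L'} + τ·2^{L+L'}
  have htot : ((∑ u : Fin L → Bool, distFail D (Γ u) : ℕ) : ℝ) ≤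
      ((far D Γ τ).card : ℝ) * (2 : ℝ) ^ L' + τ * (2 : ℝ) ^ (L + L') := by
    push_cast
    have hfar_eq : far D Γ τ =
        univ.filter fun u : Fin L → Bool => ¬ ((distFail D (Γ u) : ℝ) < τ * (2 : ℝ) ^ L') := by
      unfold far
      ext u
      simp only [Finset.mem_filter, Finset.mem_univ, true_and, not_lt]
    have hsplit : ∑ u : Fin L → Bool, (distFail D (Γ u) : ℝ) =
        (∑ u ∈ far D Γ τ, (distFail D (Γ u) : ℝ)) + ∑ u ∈ near D Γ τ, (distFail D (Γ u) : ℝ) := by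
      rw [hfar_eq, add_comm]
      unfold near
      exact (Finset.sum_filter_add_sum_filter_not _ _ _).symm
    rw [hsplit]
    have hfar : ∑ u ∈ far D Γ τ, (distFail D (Γ u) : ℝ) ≤ ((far D Γ τ).card : ℝ) * (2 : ℝ) ^ L' := by
      calc ∑ u ∈ far D Γ τ, (distFail D (Γ u) : ℝ) ≤ ∑ _u ∈ far D Γ τ, (2 : ℝ) ^ L' :=
            Finset.sum_le_sum fun u _ => by exact_mod_cast distFail_le_pow D (Γ u)
        _ = ((far D Γ τ).card : ℝ) * (2 : ℝ) ^ L' := by rw [Finset.sum_const, nsmul_eq_mul]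
    have hnear : ∑ u ∈ near D Γ τ, (distFail D (Γ u) : ℝ) ≤ τ * (2 : ℝ) ^ (L + L') := by
      calc ∑ u ∈ near D Γ τ, (distFail D (Γ u) : ℝ) ≤ ∑ _u ∈ near D Γ τ, τ * (2 : ℝ) ^ L' :=
            Finset.sum_le_sum fun u hu => by
              unfold near at hu
              exact (Finset.mem_filter.1 hu).2.le
        _ = ((near D Γ τ).card : ℝ) * (τ * (2 : ℝ) ^ L') := by rw [Finset.sum_const, nsmul_eq_mul]
        _ ≤ (2 : ℝ) ^ L * (τ * (2 : ℝ) ^ L') := by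
            refine mul_le_mul_of_nonneg_right ?_ (by positivity)
            have : (near D Γ τ).card ≤ 2 ^ L := by
              calc (near D Γ τ).card ≤ (univ : Finset (Fin L → Bool)).card :=
                    Finset.card_le_card (Finset.filter_subset _ _)
                _ = 2 ^ L := by rw [Finset.card_univ, Fintype.card_fun, Fintype.card_bool, Fintype.card_fin]
            exact_mod_cast this
        _ = τ * (2 : ℝ) ^ (L + L') := by rw [pow_add]; ring
    linarith
  -- (2) class-r cost ≥ (τ/c)·2^{L'}·|FAR_{τ/c} ∩ cls r|
  have hcls : τ / c * (2 : ℝ) ^ L' * ((far D Γ (τ / c) ∩ cls L r).card : ℝ) ≤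
      ((∑ u ∈ cls L r, distFail D (Γ u) : ℕ) : ℝ) := by
    push_cast
    calc τ / c * (2 : ℝ) ^ L' * ((far D Γ (τ / c) ∩ cls L r).card : ℝ)
        = ∑ _u ∈ far D Γ (τ / c) ∩ cls L r, τ / c * (2 : ℝ) ^ L' := by
          rw [Finset.sum_const, nsmul_eq_mul]; ring
      _ ≤ ∑ u ∈ far D Γ (τ / c) ∩ cls L r, (distFail D (Γ u) : ℝ) :=
          Finset.sum_le_sum fun u hu => by
            have hu' := (Finset.mem_inter.1 hu).1
            unfold far at hu'
            exact (Finset.mem_filter.1 hu').2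
      _ ≤ ∑ u ∈ cls L r, (distFail D (Γ u) : ℝ) :=
          Finset.sum_le_sum_of_subset_of_nonneg Finset.inter_subset_right
            (fun u _ _ => by positivity)
  -- (3) combine with far-set balance
  have hstep : τ * κ' / c * ((∑ u : Fin L → Bool, distFail D (Γ u) : ℕ) : ℝ) ≤
      τ * κ' / c * (((far D Γ τ).card : ℝ) * (2 : ℝ) ^ L' + τ * (2 : ℝ) ^ (L + L')) :=
    mul_le_mul_of_nonneg_left htot (by positivity)
  have hfsb' : τ / c * (2 : ℝ) ^ L' * (κ' * ((far D Γ τ).card : ℝ) - τ'' * (2 : ℝ) ^ L) ≤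
      τ / c * (2 : ℝ) ^ L' * ((far D Γ (τ / c) ∩ cls L r).card : ℝ) :=
    mul_le_mul_of_nonneg_left hfsb (by positivity)
  have hpow : (2 : ℝ) ^ (L + L') = (2 : ℝ) ^ L * (2 : ℝ) ^ L' := pow_add _ _ _
  rw [hpow] at hstep ⊢
  have e1 : τ * κ' / c * (((far D Γ τ).card : ℝ) * (2 : ℝ) ^ L' + τ * ((2 : ℝ) ^ L * (2 : ℝ) ^ L')) =
      τ / c * (2 : ℝ) ^ L' * (κ' * ((far D Γ τ).card : ℝ) - τ'' * (2 : ℝ) ^ L) +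
        τ / c * (κ' * τ + τ'') * ((2 : ℝ) ^ L * (2 : ℝ) ^ L') := by ring
  linarith [hstep, hfsb', hcls, e1]

/-- **`FSBSuff ⟹ LDMAAddSuff`**: given `ε`, take `τ = ε/2`, `τ'' = κ'ε/2`. -/
theorem ldmaAddSuff_of_fsbSuff (h : FSBSuff) : LDMAAddSuff := by
  obtain ⟨c, hc, κ', hκ', hF⟩ := h
  intro ε hε
  have hcpos : (0 : ℝ) < c := by linarith
  refine ⟨ε / 2 * κ' / c, by positivity, ?_⟩
  have h := ldmaAdd_of_fsb hc hκ' (by positivity : (0 : ℝ) < ε / 2)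
    (hF (ε / 2) (by positivity) (κ' * (ε / 2)) (by positivity))
  have e : ε / 2 / c * (κ' * (ε / 2) + κ' * (ε / 2)) = ε * (ε / 2 * κ' / c) := by
    field_simp
    ring
  rw [e] at h
  exact h

/-! ### P6c: a farness witness plus PLDAMS gives far-set balance -/

/-- **`FW` + PLDAMS ⟹ `FSB`** at one scale (`Sketch8b.FSBOfFW`, quantitative form): with PLDAMS
constant `κ₀ ≥ b` at the witness' degree profile, `κ' = a(κ₀ − b)` and slack `(κ₀ − b)τ''`. -/
theorem fsb_of_fw {κ₀ : ℝ} {D' : ℕ → ℕ} (hP : PLDAMSBool κ₀ D') {c a b τ τ'' : ℝ}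
    (hb : b ≤ κ₀) (h : FW D' c a b τ τ'') : FSB c (a * (κ₀ - b)) τ ((κ₀ - b) * τ'') := by
  obtain ⟨n₀, hP⟩ := hP
  intro C
  obtain ⟨L₁, hL₁⟩ := h C
  refine ⟨max L₁ n₀, fun L L' hL hL' D hD Γ hΓ r => ?_⟩
  obtain ⟨p, hpdeg, hcap, hleak⟩ :=
    hL₁ L L' (le_trans (le_max_left _ _) hL) (le_trans (le_max_left _ _) hL') D hD Γ hΓ r
  set S := univ.filter fun u : Fin L → Bool => p u = true with hS
  have hPL := hP L (le_trans (le_max_right _ _) hL) p hpdeg r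
  -- |supp p ∩ cls r| ≥ κ₀ |supp p|
  have hScls : (univ.filter fun u : Fin L → Bool => p u = true ∧ wt u % 3 = r % 3) = S ∩ cls L r := by
    unfold cls
    rw [hS, ← Finset.filter_and]
  rw [hScls] at hPL
  -- (S ∩ cls r) \ NEAR ⊆ FAR_{τ/c} ∩ cls r
  have hsub : (S ∩ cls L r).card ≤ (far D Γ (τ / c) ∩ cls L r).card + (S ∩ near D Γ (τ / c) ∩ cls L r).card := by
    calc (S ∩ cls L r).card
        ≤ ((far D Γ (τ / c) ∩ cls L r) ∪ (S ∩ near D Γ (τ / c) ∩ cls L r)).card := by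
          refine Finset.card_le_card ?_
          intro u hu
          rw [Finset.mem_inter] at hu
          rw [Finset.mem_union, Finset.mem_inter, Finset.mem_inter, Finset.mem_inter, far_eq_compl_near,
            Finset.mem_filter]
          by_cases hn : u ∈ near D Γ (τ / c)
          · exact Or.inr ⟨⟨hu.1, hn⟩, hu.2⟩
          · exact Or.inl ⟨⟨Finset.mem_univ _, hn⟩, hu.2⟩
      _ ≤ (far D Γ (τ / c) ∩ cls L r).card + (S ∩ near D Γ (τ / c) ∩ cls L r).card :=
          Finset.card_union_le _ _
  have hsub' : ((S ∩ cls L r).card : ℝ) ≤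
      ((far D Γ (τ / c) ∩ cls L r).card : ℝ) + ((S ∩ near D Γ (τ / c) ∩ cls L r).card : ℝ) := by
    exact_mod_cast hsub
  -- |S| ≥ |S ∩ FAR_τ| ≥ a|FAR_τ| − τ''2^L
  have hSfar : ((S ∩ far D Γ τ).card : ℝ) ≤ (S.card : ℝ) := by
    exact_mod_cast Finset.card_le_card Finset.inter_subset_left
  have hkb : (0 : ℝ) ≤ κ₀ - b := by linarith
  -- chain: (κ₀ − b)|S| ≤ |S ∩ cls| − |S ∩ NEAR ∩ cls| ≤ |FAR_{τ/c} ∩ cls|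
  have hmain : (κ₀ - b) * (S.card : ℝ) ≤ ((far D Γ (τ / c) ∩ cls L r).card : ℝ) := by
    have : (κ₀ - b) * (S.card : ℝ) = κ₀ * (S.card : ℝ) - b * (S.card : ℝ) := by ring
    linarith [hPL, hleak, hsub']
  calc a * (κ₀ - b) * ((far D Γ τ).card : ℝ) - (κ₀ - b) * τ'' * (2 : ℝ) ^ L
      = (κ₀ - b) * (a * ((far D Γ τ).card : ℝ) - τ'' * (2 : ℝ) ^ L) := by ring
    _ ≤ (κ₀ - b) * ((S ∩ far D Γ τ).card : ℝ) := mul_le_mul_of_nonneg_left hcap hkb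
    _ ≤ (κ₀ - b) * (S.card : ℝ) := mul_le_mul_of_nonneg_left hSfar hkb
    _ ≤ ((far D Γ (τ / c) ∩ cls L r).card : ℝ) := hmain

/-- **`FWSuff D' ⟹ FSBSuff`** given PLDAMS with constant `κ₀ > 0` at profile `D'`
(`Sketch8b.FSBOfFW` verbatim): leakage `b = κ₀/2`, `κ' = aκ₀/2`, slack `τ''` from `2τ''/κ₀`. -/
theorem fsbSuff_of_fwSuff :
    ∀ (κ₀ : ℝ) (D' : ℕ → ℕ), 0 < κ₀ → PLDAMSBool κ₀ D' → FWSuff D' → FSBSuff := by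
  intro κ₀ D' hκ₀ hP hW
  obtain ⟨c, hc, a, ha, hFW⟩ := hW
  refine ⟨c, hc, a * (κ₀ - κ₀ / 2), by nlinarith, fun τ hτ τ'' hτ'' => ?_⟩
  have h := fsb_of_fw hP (c := c) (τ := τ) (by linarith : κ₀ / 2 ≤ κ₀)
    (hFW (κ₀ / 2) (by positivity) τ hτ (τ'' / (κ₀ - κ₀ / 2)) (by
      have : (0 : ℝ) < κ₀ - κ₀ / 2 := by linarith
      positivity))
  have e : (κ₀ - κ₀ / 2) * (τ'' / (κ₀ - κ₀ / 2)) = τ'' := by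
    have : (κ₀ - κ₀ / 2) ≠ 0 := by
      have : (0 : ℝ) < κ₀ - κ₀ / 2 := by linarith
      exact this.ne'
    field_simp
  rw [e] at h
  exact h

/-! ### The chain assembled -/

/-- **The level-set chain at a general degree profile**: PLDAMS at profile `D'` (constant `κ₀ > 0`),
a farness witness family `FWSuff D'` and elimination hardness give the product bound. -/
theorem productHard_of_fwSuff_of_elimHard {κ₀ : ℝ} {D' : ℕ → ℕ} (hκ₀ : 0 < κ₀)
    (hP : PLDAMSBool κ₀ D') (hW : FWSuff D')
    (hE : ∃ η₀ : ℝ, 0 < η₀ ∧ ∀ C : ℕ, ∃ n₀ : ℕ, ∀ n ≥ n₀, ∀ a b : CubeFn (ZMod 2) n,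
      a ∈ lowDeg (ZMod 2) n ((Nat.log 2 n) ^ C) → b ∈ lowDeg (ZMod 2) n ((Nat.log 2 n) ^ C) →
        ∀ dec : ZMod 2 → ZMod 2 → ℕ,
          η₀ * (2 : ℝ) ^ n ≤ ((univ.filter fun u : Fin n → Bool =>
            dec (a u) (b u) % 3 = Hegedus.wt u % 3).card : ℝ)) :
    ∃ μ : ℝ, 0 < μ ∧ ∀ C : ℕ, ∃ L₀ : ℕ, ∀ L L' : ℕ, L₀ ≤ L → L₀ ≤ L' →
      ∀ X Y : (Fin L → Bool) → (Fin L' → Bool) → Bool,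
        (∀ v, IsElimWin ((Nat.log 2 (min L L')) ^ C) (fun u => X u v)) →
        (∀ u, IsElimWin ((Nat.log 2 (min L L')) ^ C) (fun v => Y u v)) →
          μ * (2 : ℝ) ^ (L + L') ≤ (agreeCountR X Y : ℝ) :=
  productHard_of_ldmaAddSuff_of_elimHard (ldmaAddSuff_of_fsbSuff (fsbSuff_of_fwSuff κ₀ D' hκ₀ hP hW)) hE

/-- **Line product after §20.7, in the kernel**: a low-degree farness witness with column degree
`⌊c√L⌋` (some `c > 0`), via `pldamsBool_sqrt`, far-set balance and additive LDMA, gives the product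
bound `ProductHardPolylog` from elimination hardness (bodies verbatim). -/
theorem productHard_of_fwSuff_sqrt_of_elimHard
    (hW : ∃ c : ℝ, 0 < c ∧ ∀ c' : ℝ, 0 < c' → c' ≤ c → FWSuff (fun n => ⌊c' * Real.sqrt n⌋₊))
    (hE : ∃ η₀ : ℝ, 0 < η₀ ∧ ∀ C : ℕ, ∃ n₀ : ℕ, ∀ n ≥ n₀, ∀ a b : CubeFn (ZMod 2) n,
      a ∈ lowDeg (ZMod 2) n ((Nat.log 2 n) ^ C) → b ∈ lowDeg (ZMod 2) n ((Nat.log 2 n) ^ C) →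
        ∀ dec : ZMod 2 → ZMod 2 → ℕ,
          η₀ * (2 : ℝ) ^ n ≤ ((univ.filter fun u : Fin n → Bool =>
            dec (a u) (b u) % 3 = Hegedus.wt u % 3).card : ℝ)) :
    ∃ μ : ℝ, 0 < μ ∧ ∀ C : ℕ, ∃ L₀ : ℕ, ∀ L L' : ℕ, L₀ ≤ L → L₀ ≤ L' →
      ∀ X Y : (Fin L → Bool) → (Fin L' → Bool) → Bool,
        (∀ v, IsElimWin ((Nat.log 2 (min L L')) ^ C) (fun u => X u v)) →
        (∀ u, IsElimWin ((Nat.log 2 (min L L')) ^ C) (fun v => Y u v)) →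
          μ * (2 : ℝ) ^ (L + L') ≤ (agreeCountR X Y : ℝ) := by
  obtain ⟨κ₀, hκ₀, c₀, hc₀, hP⟩ := pldamsBool_sqrt
  obtain ⟨c, hc, hWc⟩ := hW
  -- use the witness at degree profile min(c, c₀)·√n ≤ c₀·√n, where PLDAMS holds by monotonicity
  have hmin : 0 < min c c₀ := lt_min hc hc₀
  have hW' : FWSuff (fun n => ⌊min c c₀ * Real.sqrt n⌋₊) := hWc (min c c₀) hmin (min_le_left _ _)
  have hP' : PLDAMSBool κ₀ (fun n => ⌊min c c₀ * Real.sqrt n⌋₊) := by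
    obtain ⟨n₀, hP⟩ := hP
    refine ⟨n₀, fun n hn f hf r => hP n hn f ?_ r⟩
    have hle : ⌊min c c₀ * Real.sqrt n⌋₊ ≤ ⌊c₀ * Real.sqrt n⌋₊ :=
      Nat.floor_le_floor (mul_le_mul_of_nonneg_right (min_le_right _ _) (Real.sqrt_nonneg _))
    exact lowDeg_mono hle hf
  exact productHard_of_ldmaAddSuff_of_elimHard
    (ldmaAddSuff_of_fsbSuff (fsbSuff_of_fwSuff κ₀ _ hκ₀ hP' hW')) hE

end Summit.QuantumAdvantage.AdviceFreeQNC0
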